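import Summits.AtomisticToContinuum.Crystallization.Theorems.FrustratedLawDichotomyStrainedPatchHomEntryLeafHT3

/-!
# `entryLeafOKHT4`: the analytic-slab leaf with a GENERIC INNER VERDICT run as a certificate SUB-TREE over the confined ξ-box
# (27623 `(H) HomFloor (1/625)`, hcp half; critic rows 1108 (3) (iii) / 1110 (2); T3/T4)

decomp-a2c hand-1 g29 (crux `AperiodicFrustratedLawGap`, stmt-AtomisticToContinuum-27623).  KERNEL FINDING: at `0.8 t_b` the sharp fit leaf `fitOKHS`
passes on ξ-boxes of half-width `≤ 1.25·10⁻³` (`U`-width `2⁻¹³`) or `2⁻¹³` (`U`-width `2⁻¹¹`) but NOT on the whole confined box `(3.2, 4.2, 1.5)·10⁻³` of the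
slab leaf — so the inner verdict must be a small certificate TREE over the confined box, not one leaf.  This file makes the inner verdict a parameter and
runs it through `…HomCertTree.treeOK` on the confined box with widths rounded up to multiples of `64` (six bisection levels per coordinate):

* §1 `htCertSide p c w` (every conjunct of `entryLeafOKHT3` except the inner verdict), `htWr` (rounded-up confined widths, `htW ≤ htWr`),
  ★ `entryLeafOKHT4 inner p t c w := htCertSide p c w && treeOK inner t c (htWr p c w)`;
* §2 ★★★ `entryLeafOKHT4_sound` — for ANY inner verdict sound in the hver shape, the leaf is sound in the hver shape (slab parts as in `entryLeafOKHT3_sound`,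
  inner step by `…HomCertTree.treeOK_sound` at the point `(U_ab, ξ_i)` of the confined box);
* §3 the instance of record `entryLeafOKHT4Q μ p t := entryLeafOKHT4 (entryLeafOKHQ μ) p t` (the cheap quick verdict: prunes, tables, `fitOKHS`, `fitOKH`, …)
  with `entryLeafOKHT4Q_sound`, the union `entryLeafOKHT4QX μ P T` for payload FUNCTIONS `P` (certificate) and `T` (sub-tree), `hcpHalf_of_entryTreeHT4QX`,
  ★★★ `homFloor_625_of_entryTrees6RBKP_HT4QX`.

Kernel definitions + soundness; 0 sorry; standard axioms; no instances / notation / `#eval`.  `--supports stmt-AtomisticToContinuum-27623`.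
-/

noncomputable section

namespace Summit.AtomisticToContinuum.Crystallization.Theorems.FrustratedLawDichotomyStrainedPatchHomEntryLeafHT

open scoped BigOperators RealInnerProductSpace
open Literature.Analysis.ValidatedNumerics.Numerics
open Summit.AtomisticToContinuum.Crystallization.Theorems.ChargedEnergyGapNegative (E3)
open Summit.AtomisticToContinuum.Crystallization.Theorems.FrustratedLawDichotomySchurCut (effPot w₄₅ ω₄)
open Summit.AtomisticToContinuum.Crystallization.Theorems.FrustratedLawDichotomyAveragingRuleTightFree (TightNearCap BadNearCap)
open Summit.AtomisticToContinuum.Crystallization.Theorems.FrustratedLawDichotomyExemptAbsorption (ExemptNear)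
open Summit.AtomisticToContinuum.Crystallization.Theorems.FrustratedLawDichotomyStrainedPatchHomSplit (ExRec latPt hexFrame hcpShift HomFloor)
open Summit.AtomisticToContinuum.Crystallization.Theorems.FrustratedLawDichotomyStrainedPatchTaylorChord (segGd)
open Summit.AtomisticToContinuum.Crystallization.Theorems.FrustratedLawDichotomyStrainedPatchHomEntryGram (entryFI mem_entryFI)
open Summit.AtomisticToContinuum.Crystallization.Theorems.FrustratedLawDichotomyStrainedPatchHomEntryGramHcp (dot3 shufFI mem_dot3 mem_shufFI)
open Summit.AtomisticToContinuum.Crystallization.Theorems.FrustratedLawDichotomyStrainedPatchHomForceKit (vecB mem_vecB)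
open Summit.AtomisticToContinuum.Crystallization.Theorems.FrustratedLawDichotomyStrainedPatchHomHertzKit (hertzTest quadForm_ge_of_hertzTest)
open Summit.AtomisticToContinuum.Crystallization.Theorems.FrustratedLawDichotomyStrainedPatchHomCurvCentreKit (cenShuf cenShuf_apply)
open Summit.AtomisticToContinuum.Crystallization.Theorems.FrustratedLawDichotomyStrainedPatchHomCurvLeaf
  (nodup_filter_append toFinset_filter_append)
open Summit.AtomisticToContinuum.Crystallization.Theorems.FrustratedLawDichotomyStrainedPatchHomCurvLeafL2 (refW)
open Summit.AtomisticToContinuum.Crystallization.Theorems.FrustratedLawDichotomyStrainedPatchHomCurvLJ (isCenLJ curvCheckLJM)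
open Summit.AtomisticToContinuum.Crystallization.Theorems.FrustratedLawDichotomyStrainedPatchHomForceJacN
  (fjQ fjVec fjE fjX forceJacCheckN boxLabels11 boxLabels11_toFinset boxLabels11_nodup)
open Summit.AtomisticToContinuum.Crystallization.Theorems.FrustratedLawDichotomyStrainedPatchHomSlopeLJ (slopeLJLabelOK slopeCheckLJ forceLJ_ref_bound_of_check)
open Summit.AtomisticToContinuum.Crystallization.Theorems.FrustratedLawDichotomyStrainedPatchHomForceHcp (xiBallOK norm_le_quarter_of_xiBallOK)
open Summit.AtomisticToContinuum.Crystallization.Theorems.FrustratedLawDichotomyStrainedPatchHomCurvLeafHCC (entryLeafOKHCCX entryLeafOKHCCX_sound)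
open Summit.AtomisticToContinuum.Crystallization.Theorems.FrustratedLawDichotomyStrainedPatchHomSlabConfine (abs_apply_le_of_qcert)
open Summit.AtomisticToContinuum.Crystallization.Theorems.FrustratedLawDichotomyStrainedPatchHomSlabLeaf
  (jac_floorM_of_three_checks abs_coord_le_of_confined hver_of_slabParts)
open Summit.AtomisticToContinuum.Crystallization.Theorems.FrustratedLawDichotomyStrainedPatchHomPrunedPolar (homFloor_of_prunedBoxSums_selfAdjoint)
open Summit.AtomisticToContinuum.Crystallization.Theorems.FrustratedLawDichotomyStrainedPatchHomCertTree (CertTree treeOK)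
open Summit.AtomisticToContinuum.Crystallization.Theorems.FrustratedLawDichotomyStrainedPatchHomEntryGram (rootC rootW)
open Summit.AtomisticToContinuum.Crystallization.Theorems.FrustratedLawDichotomyStrainedPatchHomEntryGramHcp (rootCH rootWH)
open Summit.AtomisticToContinuum.Crystallization.Theorems.FrustratedLawDichotomyStrainedPatchHomEntryTable (muRec muRec_ok)
open Summit.AtomisticToContinuum.Crystallization.Theorems.FrustratedLawDichotomyStrainedPatchHomEntryTableP (entryLeafOK6RBKP)
open Summit.AtomisticToContinuum.Crystallization.Theorems.FrustratedLawDichotomyStrainedPatchHomEntryTreeCert (fccHalf_of_entryTree6RBKP)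
open Summit.AtomisticToContinuum.Crystallization.Theorems.FrustratedLawDichotomyStrainedPatchHomEntryFlipHcp (HcpDich hcpHalf_of_entryTreeShuf)
open Summit.AtomisticToContinuum.Crystallization.Theorems.FrustratedLawDichotomyStrainedPatchHomSlopeLJ (slopeGsLJ slopeCheckLJ_slopeGsLJ)
open Summit.AtomisticToContinuum.Crystallization.Theorems.FrustratedLawDichotomyStrainedPatchHomCurvLJ (naiveLJ)
open Summit.AtomisticToContinuum.Crystallization.Theorems.FrustratedLawDichotomyStrainedPatchHomCertTree (treeOK_sound)
open Summit.AtomisticToContinuum.Crystallization.Theorems.FrustratedLawDichotomyStrainedPatchHomEntryQuickHcp (entryLeafOKHQ entryLeafOKHQ_imp)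
open Summit.AtomisticToContinuum.Crystallization.Theorems.FrustratedLawDichotomyStrainedPatchHomLeafTableCheckHcpV (entryLeafOKHVK_sound)

/-! ## §1. The certificate side, rounded widths, the leaf -/

/-- Every conjunct of `entryLeafOKHT3` except the inner verdict. -/
def htCertSide (p : HTCert) (c w : (Fin 3 × Fin 3) ⊕ Fin 3 → ℤ) : Bool :=
  xiBallOK c w && htROK c w && htCertOK p c w &&
    curvCheckLJM c w (htCen c w) (htNai c w) p.D p.lam₁ && forceJacCheckN c w (htFar1 c w) p.lam₂ && forceJacCheckN c w (htFar2 c w) p.lam₃ &&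
    (htNaiOK c w (htNear c w) && htNaiOK c w (htFar1 c w) && htNaiOK c w (htFar2 c w)) &&
    decide (htGs c w (htNear c w) + htGs c w (htFar1 c w) + htGs c w (htFar2 c w) ≤ p.Gs)

/-- The confined box with ξ-half-widths rounded UP to multiples of `64` (so that six bisections per coordinate keep the widths even). -/
def htWr (p : HTCert) (c w : (Fin 3 × Fin 3) ⊕ Fin 3 → ℤ) : (Fin 3 × Fin 3) ⊕ Fin 3 → ℤ :=
  Sum.elim (fun ab => w (Sum.inl ab)) fun k => 64 * cdiv (htW p c w (Sum.inr k)) 64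

/-- `htWr` keeps the entry half-widths. [formal bookkeeping] -/
theorem htWr_inl (p : HTCert) (c w : (Fin 3 × Fin 3) ⊕ Fin 3 → ℤ) (ab : Fin 3 × Fin 3) : htWr p c w (Sum.inl ab) = w (Sum.inl ab) := rfl

/-- Rounding up enlarges the box: `htW ≤ htWr` on the shuffle coordinates. [arithmetic] -/
theorem htW_le_htWr (p : HTCert) (c w : (Fin 3 × Fin 3) ⊕ Fin 3 → ℤ) (k : Fin 3) : htW p c w (Sum.inr k) ≤ htWr p c w (Sum.inr k) := by
  show htW p c w (Sum.inr k) ≤ 64 * cdiv (htW p c w (Sum.inr k)) 64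
  unfold cdiv
  omega

/-- ★ **THE ANALYTIC-SLAB LEAF WITH AN INNER CERTIFICATE SUB-TREE**: certificate side ∧ `treeOK inner t` on the (rounded) confined box. -/
def entryLeafOKHT4 (inner : ((Fin 3 × Fin 3) ⊕ Fin 3 → ℤ) → ((Fin 3 × Fin 3) ⊕ Fin 3 → ℤ) → Bool) (p : HTCert) (t : CertTree ((Fin 3 × Fin 3) ⊕ Fin 3))
    (c w : (Fin 3 × Fin 3) ⊕ Fin 3 → ℤ) : Bool :=
  htCertSide p c w && treeOK inner t c (htWr p c w)

/-! ## §2. ★★★ Soundness -/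

/-- ★★★ **SOUNDNESS OF `entryLeafOKHT4` IN THE hver SHAPE, FOR ANY SOUND INNER VERDICT.** [folklore chaining: `entryLeafOKHT3_sound` with the inner
step through `…HomCertTree.treeOK_sound`] -/
theorem entryLeafOKHT4_sound {μ : ℤ} {inner : ((Fin 3 × Fin 3) ⊕ Fin 3 → ℤ) → ((Fin 3 × Fin 3) ⊕ Fin 3 → ℤ) → Bool}
    (hinner : ∀ c w, inner c w = true → ∀ (U : E3 →L[ℝ] E3) (ξ : E3), (∀ v v' : E3, ⟪U v, v'⟫ = ⟪v, U v'⟫) → ‖U - 1‖ ≤ 1 / 4 →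
      (∀ ab : Fin 3 × Fin 3, |(U (EuclideanSpace.single ab.2 (1 : ℝ))) ab.1 - (c (Sum.inl ab) : ℝ) / SC| ≤ (w (Sum.inl ab) : ℝ) / SC) →
      (∀ i : Fin 3, |ξ i - (c (Sum.inr i) : ℝ) / SC| ≤ (w (Sum.inr i) : ℝ) / SC) → 0 ≤ ξ 0 → 0 ≤ ξ 2 →
      (∀ (M : ℕ) (z : Fin M → E3) (cc : Fin M), Function.Injective z →
          Set.range z = {x : E3 | dist x (z cc) ≤ 133 / 10 ∧ ∃ a : Fin 3 → ℤ,
            x = z cc + latPt U hexFrame a ∨ x = z cc + latPt U hexFrame a + U (hcpShift + ξ)} →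
          TightNearCap (9 / 5) (3 / 2) z cc ∨ ExemptNear (9 / 5) ExRec z cc ∨ BadNearCap (9 / 5) (3 / 2) z cc) ∨
        (μ : ℝ) / SC ≤ ∑ b ∈ (Fintype.piFinset fun _ : Fin 3 => Finset.Icc (-7 : ℤ) 7).filter (fun b => b ≠ 0), effPot w₄₅ ω₄ (3 / 400) ‖latPt U hexFrame b‖ +
          ∑ b ∈ (Fintype.piFinset fun _ : Fin 3 => Finset.Icc (-7 : ℤ) 7), effPot w₄₅ ω₄ (3 / 400) ‖latPt U hexFrame b + U (hcpShift + ξ)‖)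
    {p : HTCert} {t : CertTree ((Fin 3 × Fin 3) ⊕ Fin 3)} {c w : (Fin 3 × Fin 3) ⊕ Fin 3 → ℤ} (h : entryLeafOKHT4 inner p t c w = true) (U : E3 →L[ℝ] E3) (ξ : E3)
    (hsa : ∀ v v' : E3, ⟪U v, v'⟫ = ⟪v, U v'⟫) (hU : ‖U - 1‖ ≤ 1 / 4)
    (hbox : ∀ ab : Fin 3 × Fin 3, |(U (EuclideanSpace.single ab.2 (1 : ℝ))) ab.1 - (c (Sum.inl ab) : ℝ) / SC| ≤ (w (Sum.inl ab) : ℝ) / SC)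
    (hξ : ∀ i : Fin 3, |ξ i - (c (Sum.inr i) : ℝ) / SC| ≤ (w (Sum.inr i) : ℝ) / SC) (h0 : 0 ≤ ξ 0) (h2 : 0 ≤ ξ 2) :
    (∀ (M : ℕ) (z : Fin M → E3) (cc : Fin M), Function.Injective z →
        Set.range z = {x : E3 | dist x (z cc) ≤ 133 / 10 ∧ ∃ a : Fin 3 → ℤ,
          x = z cc + latPt U hexFrame a ∨ x = z cc + latPt U hexFrame a + U (hcpShift + ξ)} →
        TightNearCap (9 / 5) (3 / 2) z cc ∨ ExemptNear (9 / 5) ExRec z cc ∨ BadNearCap (9 / 5) (3 / 2) z cc) ∨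
      (μ : ℝ) / SC ≤ ∑ b ∈ (Fintype.piFinset fun _ : Fin 3 => Finset.Icc (-7 : ℤ) 7).filter (fun b => b ≠ 0), effPot w₄₅ ω₄ (3 / 400) ‖latPt U hexFrame b‖ +
        ∑ b ∈ (Fintype.piFinset fun _ : Fin 3 => Finset.Icc (-7 : ℤ) 7), effPot w₄₅ ω₄ (3 / 400) ‖latPt U hexFrame b + U (hcpShift + ξ)‖ := by
  classical
  have hS : (0 : ℝ) < SC := by norm_num [SC]
  unfold entryLeafOKHT4 htCertSide at h
  simp only [Bool.and_eq_true, decide_eq_true_eq] at h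
  obtain ⟨⟨⟨⟨⟨⟨⟨⟨hball, hROK⟩, hcert⟩, hcurvM⟩, hfar1⟩, hfar2⟩, ⟨⟨hs1, hs2⟩, hs3⟩⟩, hGs⟩, htree⟩ := h
  obtain ⟨hT, hγ, hr, hconf⟩ := htCertOK_spec hcert
  -- the reference shuffle: the ξ-centre of the cell
  set ξ₀ : E3 := cenShuf c with hξ₀def
  have hw0 : ∀ i : Fin 3, (0 : ℝ) ≤ (w (Sum.inr i) : ℝ) / SC := fun i => (abs_nonneg _).trans (hξ i)
  have hξ₀box : ∀ i : Fin 3, |ξ₀ i - (c (Sum.inr i) : ℝ) / SC| ≤ (w (Sum.inr i) : ℝ) / SC := by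
    intro i; rw [hξ₀def, cenShuf_apply, sub_self, abs_zero]; exact hw0 i
  have hn : ‖ξ‖ ≤ 1 / 4 := norm_le_quarter_of_xiBallOK hball hξ
  have hn₀ : ‖ξ₀‖ ≤ 1 / 4 := norm_le_quarter_of_xiBallOK hball hξ₀box
  -- label finsets
  set B : Finset (Fin 3 → ℤ) := (htB c w).toFinset with hBdef
  set R : Finset (Fin 3 → ℤ) := (htR c w).toFinset with hRdef
  have hB : B ⊆ Fintype.piFinset fun _ : Fin 3 => Finset.Icc (-11 : ℤ) 11 := by
    intro b hb
    rw [← boxLabels11_toFinset]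
    exact List.mem_toFinset.2 (mem_boxLabels11_of_mem_htB (List.mem_toFinset.1 hb))
  have hBin : ∀ bb ∈ B, ‖latPt U hexFrame bb + U (hcpShift + ξ)‖ ≤ 7 :=
    fun bb hbb => norm_le_seven_of_htIn U hbox ξ hξ (htIn_of_mem_htB (List.mem_toFinset.1 hbb))
  have hR : ∀ bb ∈ (Fintype.piFinset fun _ : Fin 3 => Finset.Icc (-11 : ℤ) 11) \ B, ‖latPt U hexFrame bb + U (hcpShift + ξ)‖ ≤ 7 →
      bb ∈ R ∧ 6 ≤ ‖latPt U hexFrame bb + U (hcpShift + ξ)‖ := by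
    intro bb hbb h7
    obtain ⟨hbox11, hnotB⟩ := Finset.mem_sdiff.1 hbb
    rw [← boxLabels11_toFinset] at hbox11
    have hbL : bb ∈ boxLabels11 := List.mem_toFinset.1 hbox11
    have hlo := lo_le_of_norm_le_seven U hbox ξ hξ h7
    by_cases hin : htIn c w bb = true
    · exact absurd (List.mem_toFinset.2 (mem_htB_of_htIn hbL hin)) hnotB
    · have hmemR : bb ∈ htR c w := by
        refine List.mem_filter.2 ⟨hbL, ?_⟩
        simp only [Bool.and_eq_true, Bool.not_eq_true', decide_eq_true_eq]
        exact ⟨by simpa using hin, hlo⟩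
      have h36 : 36 * (SC : ℤ) ≤ (fjQ c w bb).lo := by
        have := List.all_eq_true.1 hROK bb hmemR
        simpa using this
      exact ⟨List.mem_toFinset.2 hmemR, six_le_norm_of_lo U hbox ξ hξ h36⟩
  -- the Q-floor along the segment
  have hcurv : ∀ s ∈ Set.Ioo (0 : ℝ) 1,
      ((p.lam₁ + p.lam₂ + p.lam₃ : ℤ) : ℝ) / SC * ‖U (ξ - ξ₀)‖ ^ 2 + ∑ i : Fin 3, ∑ j : Fin 3, (p.D i j : ℝ) / SC * ((U (ξ - ξ₀)) i * (U (ξ - ξ₀)) j) ≤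
        ∑ bb ∈ B, segGd (fun x : ℝ => x⁻¹ ^ 7 - x⁻¹ ^ 13) (latPt U hexFrame bb + U (hcpShift + ξ₀)) (U (ξ - ξ₀)) s :=
    fun s hs => jac_floorM_of_three_checks (htB_nodup c w) hcurvM hfar1 hfar2 U hU hbox ξ₀ ξ hξ₀box hξ hn₀ hn hs
  -- the reference force bound, chunked
  have hf₀ : |∑ bb ∈ B, (‖latPt U hexFrame bb + U (hcpShift + ξ₀)‖⁻¹ ^ 8 - ‖latPt U hexFrame bb + U (hcpShift + ξ₀)‖⁻¹ ^ 14) *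
      ⟪latPt U hexFrame bb + U (hcpShift + ξ₀), U (ξ - ξ₀)⟫| ≤ (p.Gs : ℝ) / SC * ‖U (ξ - ξ₀)‖ := by
    have key := refForce_htB_le hs1 hs2 hs3 U hU hbox hn₀ ξ
    refine key.trans (mul_le_mul_of_nonneg_right ?_ (norm_nonneg _))
    rw [div_le_div_iff_of_pos_right hS]
    exact_mod_cast hGs
  -- slab ⟹ confinement ⟹ the inner verdict on the confined box
  have hslab : ((p.lam₁ + p.lam₂ + p.lam₃ : ℤ) : ℝ) / SC * ‖U (ξ - ξ₀)‖ ^ 2 +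
        ∑ i : Fin 3, ∑ j : Fin 3, (p.D i j : ℝ) / SC * ((U (ξ - ξ₀)) i * (U (ξ - ξ₀)) j) ≤
      ((6000 / 343 * (7 : ℝ)⁻¹ ^ 4 + 2880 / 49 * (7 : ℝ)⁻¹ ^ 5 + 10 / 7 * (7 : ℝ)⁻¹ ^ 6 + 2 * (7 : ℝ)⁻¹ ^ 7) + (p.Gs : ℝ) / SC +
        R.card * (6 : ℝ)⁻¹ ^ 7) * ‖U (ξ - ξ₀)‖ →
      (∀ (M : ℕ) (z : Fin M → E3) (cc : Fin M), Function.Injective z →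
          Set.range z = {x : E3 | dist x (z cc) ≤ 133 / 10 ∧ ∃ a : Fin 3 → ℤ,
            x = z cc + latPt U hexFrame a ∨ x = z cc + latPt U hexFrame a + U (hcpShift + ξ)} →
          TightNearCap (9 / 5) (3 / 2) z cc ∨ ExemptNear (9 / 5) ExRec z cc ∨ BadNearCap (9 / 5) (3 / 2) z cc) ∨
        (μ : ℝ) / SC ≤ ∑ b ∈ (Fintype.piFinset fun _ : Fin 3 => Finset.Icc (-7 : ℤ) 7).filter (fun b => b ≠ 0), effPot w₄₅ ω₄ (3 / 400) ‖latPt U hexFrame b‖ +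
          ∑ b ∈ (Fintype.piFinset fun _ : Fin 3 => Finset.Icc (-7 : ℤ) 7), effPot w₄₅ ω₄ (3 / 400) ‖latPt U hexFrame b + U (hcpShift + ξ)‖ := by
    intro hq
    have ht0 : (0 : ℝ) < (htT p c w : ℝ) / SC := div_pos (by exact_mod_cast hT) hS
    have hle := slabConst_le_htT p c w
    have hQ : (p.lamT : ℝ) / SC * ‖U (ξ - ξ₀)‖ ^ 2 + ∑ i : Fin 3, ∑ j : Fin 3, (p.D i j : ℝ) / SC * ((U (ξ - ξ₀)) i * (U (ξ - ξ₀)) j) ≤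
        (htT p c w : ℝ) / SC * ‖U (ξ - ξ₀)‖ := by
      have e : (p.lamT : ℝ) = ((p.lam₁ + p.lam₂ + p.lam₃ : ℤ) : ℝ) := by simp [HTCert.lamT]
      rw [e]
      exact hq.trans (mul_le_mul_of_nonneg_right hle (norm_nonneg _))
    have hΔk : ∀ k : Fin 3, |(U (ξ - ξ₀)) k| ≤ (p.rS k : ℝ) / SC := fun k =>
      abs_apply_le_of_qcert (Q := fun x : E3 => (p.lamT : ℝ) / SC * ‖x‖ ^ 2 + ∑ i : Fin 3, ∑ j : Fin 3, (p.D i j : ℝ) / SC * (x i * x j))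
        ht0 (div_pos (by exact_mod_cast hγ k) hS) (div_nonneg (by exact_mod_cast hr k) hS.le) k (fun x => htConf_sound (hconf k) x) hQ
    have hy := fun k => abs_coord_le_of_confined hU (ξ - ξ₀) (r := fun j => (p.rS j : ℝ) / SC) (κ := fun k => (htκ c w k : ℝ) / SC) hΔk
      (rowDev_le U hbox) k
    -- the confined box
    have hξ' : ∀ i : Fin 3, |ξ i - (c (Sum.inr i) : ℝ) / SC| ≤ (htW p c w (Sum.inr i) : ℝ) / SC := by
      intro i
      have hyi := hy i
      have e1 : (ξ - ξ₀) i = ξ i - (c (Sum.inr i) : ℝ) / SC := by rw [PiLp.sub_apply, hξ₀def, cenShuf_apply]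
      rw [e1] at hyi
      refine hyi.trans ?_
      rw [htW_inr]
      have hρ := sqrt_le_htρ p
      have hκ0 : (0 : ℝ) ≤ (htκ c w i : ℝ) / SC :=
        (Finset.sum_nonneg fun j _ => abs_nonneg _).trans (rowDev_le U hbox i)
      have hρ0 : (0 : ℝ) ≤ (htρ p : ℝ) := by
        have := (Real.sqrt_nonneg _).trans hρ
        rw [le_div_iff₀ hS, zero_mul] at this; exact this
      have hcd := div_le_cdiv (a := htκ c w i * 4 * htρ p) (b := 3 * (SC : ℤ)) (by norm_num [SC])
      have step : (htκ c w i : ℝ) / SC * (4 / 3 * Real.sqrt (∑ j : Fin 3, ((p.rS j : ℝ) / SC) ^ 2)) ≤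
          ((cdiv (htκ c w i * 4 * htρ p) (3 * SC) : ℤ) : ℝ) / SC := by
        have h1 : (htκ c w i : ℝ) / SC * (4 / 3 * Real.sqrt (∑ j : Fin 3, ((p.rS j : ℝ) / SC) ^ 2)) ≤
            (htκ c w i : ℝ) / SC * (4 / 3 * ((htρ p : ℝ) / SC)) := by gcongr
        refine h1.trans ?_
        rw [le_div_iff₀ hS]
        have e : (htκ c w i : ℝ) / SC * (4 / 3 * ((htρ p : ℝ) / SC)) * SC = ((htκ c w i * 4 * htρ p : ℤ) : ℝ) / ((3 * (SC : ℤ) : ℤ) : ℝ) := by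
          push_cast; field_simp
        rw [e]; exact hcd
      push_cast
      rw [add_div]
      linarith
    -- the point `(U_ab, ξ_i)` lies in the rounded confined box; run the inner certificate tree there
    have hx : ∀ k, |(Sum.elim (fun ab : Fin 3 × Fin 3 => (U (EuclideanSpace.single ab.2 (1 : ℝ))) ab.1) (fun i : Fin 3 => ξ i) k) -
        (c k : ℝ) / SC| ≤ (htWr p c w k : ℝ) / SC := by
      intro k
      rcases k with ab | i
      · exact hbox ab
      · refine (hξ' i).trans ?_
        rw [div_le_div_iff_of_pos_right hS]
        exact_mod_cast htW_le_htWr p c w i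
    have key := treeOK_sound SC_pos
      (P := fun x : (Fin 3 × Fin 3) ⊕ Fin 3 → ℝ => ∀ (V : E3 →L[ℝ] E3) (η : E3), (∀ v v' : E3, ⟪V v, v'⟫ = ⟪v, V v'⟫) → ‖V - 1‖ ≤ 1 / 4 →
        (∀ ab : Fin 3 × Fin 3, (V (EuclideanSpace.single ab.2 (1 : ℝ))) ab.1 = x (Sum.inl ab)) → (∀ i : Fin 3, η i = x (Sum.inr i)) → 0 ≤ η 0 → 0 ≤ η 2 →
        (∀ (M : ℕ) (z : Fin M → E3) (cc : Fin M), Function.Injective z →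
            Set.range z = {x : E3 | dist x (z cc) ≤ 133 / 10 ∧ ∃ a : Fin 3 → ℤ,
              x = z cc + latPt V hexFrame a ∨ x = z cc + latPt V hexFrame a + V (hcpShift + η)} →
            TightNearCap (9 / 5) (3 / 2) z cc ∨ ExemptNear (9 / 5) ExRec z cc ∨ BadNearCap (9 / 5) (3 / 2) z cc) ∨
          (μ : ℝ) / SC ≤ ∑ b ∈ (Fintype.piFinset fun _ : Fin 3 => Finset.Icc (-7 : ℤ) 7).filter (fun b => b ≠ 0), effPot w₄₅ ω₄ (3 / 400) ‖latPt V hexFrame b‖ +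
            ∑ b ∈ (Fintype.piFinset fun _ : Fin 3 => Finset.Icc (-7 : ℤ) 7), effPot w₄₅ ω₄ (3 / 400) ‖latPt V hexFrame b + V (hcpShift + η)‖)
      inner (fun c' w' hv x hx' V η hVsa hV1 hVx hηx h0' h2' =>
        hinner c' w' hv V η hVsa hV1 (fun ab => by rw [hVx ab]; exact hx' (Sum.inl ab)) (fun i => by rw [hηx i]; exact hx' (Sum.inr i)) h0' h2')
      t c (htWr p c w) htree _ hx U ξ hsa hU (fun _ => rfl) (fun _ => rfl) h0 h2
    exact key
  exact hver_of_slabParts hU hn₀ hn B R hB hBin hR hcurv hf₀ hslab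



/-! ## §3. The instance of record (quick verdict inside) and the booking -/

/-- ★ The slab leaf with the QUICK hcp verdict as the inner sub-tree verdict. -/
def entryLeafOKHT4Q (μ : ℤ) (p : HTCert) (t : CertTree ((Fin 3 × Fin 3) ⊕ Fin 3)) (c w : (Fin 3 × Fin 3) ⊕ Fin 3 → ℤ) : Bool :=
  entryLeafOKHT4 (entryLeafOKHQ μ) p t c w

/-- ★★ Soundness of `entryLeafOKHT4Q` in the hver shape. [folklore chaining: `entryLeafOKHQ_imp` + `entryLeafOKHVK_sound`] -/
theorem entryLeafOKHT4Q_sound {μ : ℤ} {p : HTCert} {t : CertTree ((Fin 3 × Fin 3) ⊕ Fin 3)} {c w : (Fin 3 × Fin 3) ⊕ Fin 3 → ℤ}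
    (h : entryLeafOKHT4Q μ p t c w = true) (U : E3 →L[ℝ] E3) (ξ : E3)
    (hsa : ∀ v v' : E3, ⟪U v, v'⟫ = ⟪v, U v'⟫) (hU : ‖U - 1‖ ≤ 1 / 4)
    (hbox : ∀ ab : Fin 3 × Fin 3, |(U (EuclideanSpace.single ab.2 (1 : ℝ))) ab.1 - (c (Sum.inl ab) : ℝ) / SC| ≤ (w (Sum.inl ab) : ℝ) / SC)
    (hξ : ∀ i : Fin 3, |ξ i - (c (Sum.inr i) : ℝ) / SC| ≤ (w (Sum.inr i) : ℝ) / SC) (h0 : 0 ≤ ξ 0) (h2 : 0 ≤ ξ 2) :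
    (∀ (M : ℕ) (z : Fin M → E3) (cc : Fin M), Function.Injective z →
        Set.range z = {x : E3 | dist x (z cc) ≤ 133 / 10 ∧ ∃ a : Fin 3 → ℤ,
          x = z cc + latPt U hexFrame a ∨ x = z cc + latPt U hexFrame a + U (hcpShift + ξ)} →
        TightNearCap (9 / 5) (3 / 2) z cc ∨ ExemptNear (9 / 5) ExRec z cc ∨ BadNearCap (9 / 5) (3 / 2) z cc) ∨
      (μ : ℝ) / SC ≤ ∑ b ∈ (Fintype.piFinset fun _ : Fin 3 => Finset.Icc (-7 : ℤ) 7).filter (fun b => b ≠ 0), effPot w₄₅ ω₄ (3 / 400) ‖latPt U hexFrame b‖ +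
        ∑ b ∈ (Fintype.piFinset fun _ : Fin 3 => Finset.Icc (-7 : ℤ) 7), effPot w₄₅ ω₄ (3 / 400) ‖latPt U hexFrame b + U (hcpShift + ξ)‖ :=
  entryLeafOKHT4_sound (fun c' w' hv V η hVsa hV1 hVb hη h0' h2' => entryLeafOKHVK_sound (entryLeafOKHQ_imp μ c' w' hv) V η hVsa hV1 hVb hη h0' h2')
    h U ξ hsa hU hbox hξ h0 h2

/-- ★ The union verdict with payload FUNCTIONS: certificate `P c w` and inner sub-tree `T c w`; else the union verdict of record. -/
def entryLeafOKHT4QX (μ : ℤ) (P : ((Fin 3 × Fin 3) ⊕ Fin 3 → ℤ) → ((Fin 3 × Fin 3) ⊕ Fin 3 → ℤ) → HTCert)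
    (T : ((Fin 3 × Fin 3) ⊕ Fin 3 → ℤ) → ((Fin 3 × Fin 3) ⊕ Fin 3 → ℤ) → CertTree ((Fin 3 × Fin 3) ⊕ Fin 3))
    (c w : (Fin 3 × Fin 3) ⊕ Fin 3 → ℤ) : Bool :=
  entryLeafOKHT4Q μ (P c w) (T c w) c w || entryLeafOKHCCX μ c w

/-- ★★ Soundness of `entryLeafOKHT4QX` in the hver shape. [folklore chaining] -/
theorem entryLeafOKHT4QX_sound {μ : ℤ} {P : ((Fin 3 × Fin 3) ⊕ Fin 3 → ℤ) → ((Fin 3 × Fin 3) ⊕ Fin 3 → ℤ) → HTCert}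
    {T : ((Fin 3 × Fin 3) ⊕ Fin 3 → ℤ) → ((Fin 3 × Fin 3) ⊕ Fin 3 → ℤ) → CertTree ((Fin 3 × Fin 3) ⊕ Fin 3)}
    {c w : (Fin 3 × Fin 3) ⊕ Fin 3 → ℤ} (h : entryLeafOKHT4QX μ P T c w = true) (U : E3 →L[ℝ] E3) (ξ : E3)
    (hsa : ∀ v v' : E3, ⟪U v, v'⟫ = ⟪v, U v'⟫) (hU : ‖U - 1‖ ≤ 1 / 4)
    (hbox : ∀ ab : Fin 3 × Fin 3, |(U (EuclideanSpace.single ab.2 (1 : ℝ))) ab.1 - (c (Sum.inl ab) : ℝ) / SC| ≤ (w (Sum.inl ab) : ℝ) / SC)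
    (hξ : ∀ i : Fin 3, |ξ i - (c (Sum.inr i) : ℝ) / SC| ≤ (w (Sum.inr i) : ℝ) / SC) (h0 : 0 ≤ ξ 0) (h2 : 0 ≤ ξ 2) :
    (∀ (M : ℕ) (z : Fin M → E3) (cc : Fin M), Function.Injective z →
        Set.range z = {x : E3 | dist x (z cc) ≤ 133 / 10 ∧ ∃ a : Fin 3 → ℤ,
          x = z cc + latPt U hexFrame a ∨ x = z cc + latPt U hexFrame a + U (hcpShift + ξ)} →
        TightNearCap (9 / 5) (3 / 2) z cc ∨ ExemptNear (9 / 5) ExRec z cc ∨ BadNearCap (9 / 5) (3 / 2) z cc) ∨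
      (μ : ℝ) / SC ≤ ∑ b ∈ (Fintype.piFinset fun _ : Fin 3 => Finset.Icc (-7 : ℤ) 7).filter (fun b => b ≠ 0), effPot w₄₅ ω₄ (3 / 400) ‖latPt U hexFrame b‖ +
        ∑ b ∈ (Fintype.piFinset fun _ : Fin 3 => Finset.Icc (-7 : ℤ) 7), effPot w₄₅ ω₄ (3 / 400) ‖latPt U hexFrame b + U (hcpShift + ξ)‖ := by
  simp only [entryLeafOKHT4QX, Bool.or_eq_true] at h
  rcases h with h | h
  · exact entryLeafOKHT4Q_sound h U ξ hsa hU hbox hξ h0 h2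
  · exact entryLeafOKHCCX_sound h U ξ hsa hU hbox hξ h0 h2

/-- ★★ The hcp half from ONE certificate tree over `entryLeafOKHT4QX μ P T`. [folklore chaining] -/
theorem hcpHalf_of_entryTreeHT4QX {m : ℝ} {μ : ℤ} (hμ : 2 * (m + (-(7175 / 10000) + 3 / 400)) * SC ≤ μ)
    (P : ((Fin 3 × Fin 3) ⊕ Fin 3 → ℤ) → ((Fin 3 × Fin 3) ⊕ Fin 3 → ℤ) → HTCert)
    (T : ((Fin 3 × Fin 3) ⊕ Fin 3 → ℤ) → ((Fin 3 × Fin 3) ⊕ Fin 3 → ℤ) → CertTree ((Fin 3 × Fin 3) ⊕ Fin 3))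
    {t : CertTree ((Fin 3 × Fin 3) ⊕ Fin 3)} (h : treeOK (entryLeafOKHT4QX μ P T) t rootCH rootWH = true) :
    ∀ (U : E3 →L[ℝ] E3) (ξ : E3), (∀ v w : E3, inner ℝ (U v) w = inner ℝ v (U w)) → (∀ w : E3, 0 ≤ inner ℝ w (U w)) →
      ‖U - 1‖ ≤ 1 / 4 → ‖ξ‖ ≤ 1 / 4 → HcpDich m U ξ :=
  hcpHalf_of_entryTreeShuf hμ (entryLeafOKHT4QX μ P T) (fun _ _ hv U ξ hsa hU hbox hξ h0 h2 => entryLeafOKHT4QX_sound hv U ξ hsa hU hbox hξ h0 h2) h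

/-- ★★★ **`(H) HomFloor (1/625)` OVER THE SLAB-WITH-SUB-TREE VERDICT** (`μ = muRec`; any payload functions `P`, `T`). [folklore] -/
theorem homFloor_625_of_entryTrees6RBKP_HT4QX (P : ((Fin 3 × Fin 3) ⊕ Fin 3 → ℤ) → ((Fin 3 × Fin 3) ⊕ Fin 3 → ℤ) → HTCert)
    (T : ((Fin 3 × Fin 3) ⊕ Fin 3 → ℤ) → ((Fin 3 × Fin 3) ⊕ Fin 3 → ℤ) → CertTree ((Fin 3 × Fin 3) ⊕ Fin 3))
    (hF : ∃ t : CertTree (Fin 3 × Fin 3), treeOK (entryLeafOK6RBKP muRec) t rootC rootW = true)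
    (hH : ∃ t : CertTree ((Fin 3 × Fin 3) ⊕ Fin 3), treeOK (entryLeafOKHT4QX muRec P T) t rootCH rootWH = true) : HomFloor (1 / 625) := by
  obtain ⟨tF, htF⟩ := hF
  obtain ⟨tH, htH⟩ := hH
  exact homFloor_of_prunedBoxSums_selfAdjoint (fccHalf_of_entryTree6RBKP muRec_ok htF) (hcpHalf_of_entryTreeHT4QX muRec_ok P T htH)

end Summit.AtomisticToContinuum.Crystallization.Theorems.FrustratedLawDichotomyStrainedPatchHomEntryLeafHT

end
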